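import Mathlib
import HarnessLib
import Summits.Ventures.LatticeQCDFlow.Exactness.FlowAcceptanceOverlap
import Summits.Ventures.LatticeQCDFlow.Scaling.AutoregressivePathFaithful
import Summits.Ventures.LatticeQCDFlow.Scaling.AutoregressiveGaugePlaquetteReads

/-!
# LatticeQCDFlow / Scaling — THE METROPOLISED SINGLE-COORDINATE UPDATE WITH A LEARNED PROPOSAL: its
# equilibrium acceptance is at most the overlap of the proposal with the exact conditional,
# `ā ≤ m = 1 − (1/(2Z))∫|F − q·A_a F| dπ`

HONEST FRAMING: exact (Metropolis-corrected) sampling algorithms for lattice gauge theory;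
figures of merit are autocorrelation/cost numbers at stated couplings and volumes; no
continuum-physics claim.

Venture `LatticeQCDFlow` (cell pub-lqcd), topic `Scaling`, FANOUT row 30 (lean-1, GEN-19) — OUR WORK on
THEORY-2.md §4 row C5.  The LOCAL counterpart of the acceptance form
(`Scaling/AutoregressiveProposalAcceptance`: whole-configuration proposals): an exact sampler that
updates ONE coordinate `a` at a time by proposing `v' ∼ q(·| all other coordinates)` — a learned
single-site / single-link conditional, e.g. a flow for the one-link law of `SU(3)` given its staples —
and Metropolis–Hastings-correcting against the exact conditional.  (There is no exact heat bath for
`SU(3)`; this is the algorithm class "learned heat bath", exact by construction.)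

## Setting

`π = ⊗_ι μ` (`μ` a probability measure), a coordinate `a`, a measurable weight `F` with
`0 < c_F ≤ F ≤ C_F`, `Z = ∫F dπ`, `M = A_a F` (`M(U) = ∫ F(U[a ↦ v]) dμ(v)`; the exact conditional
density of `U_a` given the rest is `F/M`); a measurable proposal density `0 ≤ q ≤ C_q` on
configurations, normalised in `a` (`∫ q(U[a ↦ v]) dμ(v) = 1`; `q(U[a ↦ ·])` is the proposal law for
`U_a` given the other coordinates of `U`).  The EQUILIBRIUM ACCEPTANCE of the update at `a` is
`ā_a = Z⁻¹ ∫_U ∫_v ∫_{v'} min(F(U[a↦v]) q(U[a↦v']), F(U[a↦v']) q(U[a↦v])) dμ dμ dπ`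
(`siteMeanAccept_eq`: this IS `E_{U∼F/Z} E_{v'∼q(U[a↦·])} min(1, F(U[a↦v'])q(U)/(F(U)q(U[a↦v'])))`).

## What is proved (all [ours]; elementary over the parents)

* §1 plumbing: resampling identity `∫ h dπ = ∫∫ h(U[a↦v]) dμ dπ` (tree
  `integral_pi_eq_integral_integral_update'`), `∫ M dπ = Z`, `∫ M·q dπ = Z`, measurability.
* §2 per context `U`: `∫∫ min(F_v q_{v'}, F_{v'} q_v) ≤ ∫ min(F_v, M(U) q_v) dμ(v) =: g(U)` (the tree's
  per-state inequality, unnormalised).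
* §3 **`siteMeanAccept_le_overlap`** — `ā_a ≤ m := Z⁻¹∫ min(F, M·q) dπ`;
  **`siteOverlap_eq_one_sub_half_integral_abs`** — `m = 1 − (1/(2Z))∫|F − M·q| dπ`, so
  `ā_a ≤ 1 − (1/(2Z))∫|F − q·A_aF| dπ`;
  `siteMeanAccept_eq` — identification with the `min(1, ratio)` form (`F, q > 0`).
  (The floor `m² ≤ ā_a` is the companion file `Scaling/AutoregressiveSiteProposalAcceptanceFloor`.)

READING (value-free): the acceptance column of a learned single-link updater certifies, to within a
square root, the `L¹(π)` distance `∫|F − q·A_aF|` between its proposal and the exact one-link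
conditional — the SAME quantity the cell's context bounds control (a proposal for a gauge link blind
at one of its endpoints has `∫|F − q·A_aF| ≥ ∫|F − A_aF| ≥ Z⟨(1/N)Re tr U_p⟩_β`,
`Scaling/AutoregressiveGauge*`, hence `ā_a ≤ 1 − ⟨W₁ₓ₁⟩_β/2`, typed separately once those parents are
built).  NOT CLAIMED: autocorrelations of the resulting sweep; unbounded weights; the sharp constant.
No `def`, no `sorry`, nothing cited as a fact.
-/

noncomputable section

namespace Summit.Ventures.LatticeQCDFlow.Theory2.Autoregressive

open MeasureTheory Function Set
open Summit.Ventures.LatticeQCDFlow.Exactness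

variable {ι : Type*} [Fintype ι] [DecidableEq ι] {X : Type*} [MeasurableSpace X]
variable (μ : Measure X) [IsProbabilityMeasure μ]

/-! ## §1 Plumbing -/

omit [Fintype ι] [DecidableEq ι] in
/-- Bounded measurable functions are integrable for a finite measure. [folklore] -/
theorem integrable_of_measurable_abs_le {Ω : Type*} [MeasurableSpace Ω] (ν : Measure Ω) [IsFiniteMeasure ν]
    {h : Ω → ℝ} (hm : Measurable h) {C : ℝ} (hb : ∀ x, |h x| ≤ C) : Integrable h ν :=
  Integrable.mono' (integrable_const C) hm.aestronglyMeasurable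
    (ae_of_all _ fun x => by rw [Real.norm_eq_abs]; exact hb x)

/-- **Resampling one coordinate**: `∫ h dπ = ∫_U ∫_v h(U[a ↦ v]) dμ(v) dπ(U)` for bounded measurable
`h` (the tree's `integral_pi_eq_integral_integral_update'` for a probability measure). [ours] -/
theorem pi_integral_eq_integral_integral_update (a : ι) {h : (ι → X) → ℝ} (hm : Measurable h)
    {C : ℝ} (hb : ∀ ω, |h ω| ≤ C) :
    ∫ U, h U ∂Measure.pi (fun _ : ι => μ) =
      ∫ U, ∫ v, h (update U a v) ∂μ ∂Measure.pi (fun _ : ι => μ) := by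
  have huniv : (fun _ : ι => μ) a Set.univ ≠ 0 := by simp
  rw [integral_pi_eq_integral_integral_update' (fun _ : ι => μ) a huniv
    (integrable_of_measurable_abs_le _ hm hb)]
  simp

omit [IsProbabilityMeasure μ] in
/-- `A_a F (U[a ↦ v]) = A_a F (U)`. [ours] -/
theorem coordAvg_singleton_update (a : ι) (F : (ι → X) → ℝ) (U : ι → X) (v : X) :
    coordAvg μ {a} F (update U a v) = coordAvg μ {a} F U := by
  have h := coordAvg_apply_piecewise μ {a} F U (fun _ => v)
  rwa [Finset.piecewise_singleton] at h

omit [Fintype ι] in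
/-- Joint measurability of `(U, v) ↦ h(U[a ↦ v])`. [ours] -/
theorem measurable_comp_update {α : Type*} [MeasurableSpace α] (a : ι) {h : (ι → X) → α}
    (hm : Measurable h) : Measurable fun p : (ι → X) × X => h (update p.1 a p.2) :=
  hm.comp measurable_update'

/-- **`∫ A_a F dπ = ∫ F dπ`** and **`∫ (A_a F)·q dπ = ∫ F dπ`** for `q` normalised in `a`. [ours] -/
theorem pi_integral_coordAvg_singleton_facts (a : ι) {F q : (ι → X) → ℝ} (hFm : Measurable F) {CF : ℝ}
    (hFb : ∀ U, |F U| ≤ CF) (hqm : Measurable q) {Cq : ℝ} (hqb : ∀ U, |q U| ≤ Cq)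
    (hq1 : ∀ U, ∫ v, q (update U a v) ∂μ = 1) :
    ∫ U, coordAvg μ {a} F U ∂Measure.pi (fun _ : ι => μ) = ∫ U, F U ∂Measure.pi (fun _ : ι => μ) ∧
      ∫ U, coordAvg μ {a} F U * q U ∂Measure.pi (fun _ : ι => μ) =
        ∫ U, F U ∂Measure.pi (fun _ : ι => μ) := by
  have hMm : Measurable (coordAvg μ {a} F) := measurable_coordAvg μ {a} hFm
  have hMb : ∀ U, |coordAvg μ {a} F U| ≤ CF := fun U =>
    abs_le.2 (coordAvg_mem_Icc μ {a} hFm (fun η => (abs_le.1 (hFb η)).1) (fun η => (abs_le.1 (hFb η)).2) U)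
  have h1 : ∫ U, coordAvg μ {a} F U ∂Measure.pi (fun _ : ι => μ) = ∫ U, F U ∂Measure.pi (fun _ : ι => μ) := by
    rw [pi_integral_eq_integral_integral_update μ a hFm hFb]
    refine integral_congr_ae (ae_of_all _ fun U => ?_)
    exact coordAvg_singleton_of_measurable μ a hFm U
  refine ⟨h1, ?_⟩
  have hMqm : Measurable fun U => coordAvg μ {a} F U * q U := hMm.mul hqm
  rw [← h1, pi_integral_eq_integral_integral_update μ a hMqm (C := CF * Cq) (fun U => by
    rw [abs_mul]; exact mul_le_mul (hMb U) (hqb U) (abs_nonneg _) ((abs_nonneg _).trans (hMb U)))]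
  refine integral_congr_ae (ae_of_all _ fun U => ?_)
  show ∫ v, coordAvg μ {a} F (update U a v) * q (update U a v) ∂μ = coordAvg μ {a} F U
  simp only [coordAvg_singleton_update]
  rw [integral_const_mul, hq1 U, mul_one]

/-! ## §2 Per context: the two pointwise inequalities of the tree, unnormalised -/

section PerContext

variable {a : ι} {F q : (ι → X) → ℝ}

/-- For every `v`: `∫ min(F_v q_{v'}, F_{v'} q_v) dμ(v') ≤ min(F_v, M(U)·q_v)`. [ours] -/
theorem site_inner_le (hFm : Measurable F) (hF0 : ∀ U, 0 ≤ F U) {CF : ℝ} (hFb : ∀ U, F U ≤ CF)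
    (hqm : Measurable q) (hq0 : ∀ U, 0 ≤ q U) {Cq : ℝ} (hqb : ∀ U, q U ≤ Cq)
    (hq1 : ∀ U, ∫ v, q (update U a v) ∂μ = 1) (U : ι → X) (v : X) :
    ∫ v', min (F (update U a v) * q (update U a v')) (F (update U a v') * q (update U a v)) ∂μ ≤
      min (F (update U a v)) (coordAvg μ {a} F U * q (update U a v)) := by
  have hFu : Measurable fun v' => F (update U a v') := hFm.comp (measurable_update U)
  have hqu : Measurable fun v' => q (update U a v') := hqm.comp (measurable_update U)
  have hFabs : ∀ W, |F W| ≤ CF := fun W => by rw [abs_of_nonneg (hF0 W)]; exact hFb W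
  have hqabs : ∀ W, |q W| ≤ Cq := fun W => by rw [abs_of_nonneg (hq0 W)]; exact hqb W
  have hI1 : Integrable (fun v' => F (update U a v) * q (update U a v')) μ :=
    (integrable_of_measurable_abs_le μ hqu (fun v' => hqabs _)).const_mul _
  have hI2 : Integrable (fun v' => F (update U a v') * q (update U a v)) μ :=
    (integrable_of_measurable_abs_le μ hFu (fun v' => hFabs _)).mul_const _
  have hImin : Integrable (fun v' => min (F (update U a v) * q (update U a v'))
      (F (update U a v') * q (update U a v))) μ := hI1.inf hI2
  refine le_min ?_ ?_
  · calc ∫ v', min (F (update U a v) * q (update U a v')) (F (update U a v') * q (update U a v)) ∂μ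
        ≤ ∫ v', F (update U a v) * q (update U a v') ∂μ := integral_mono hImin hI1 fun v' => min_le_left _ _
      _ = F (update U a v) := by rw [integral_const_mul, hq1 U, mul_one]
  · calc ∫ v', min (F (update U a v) * q (update U a v')) (F (update U a v') * q (update U a v)) ∂μ
        ≤ ∫ v', F (update U a v') * q (update U a v) ∂μ := integral_mono hImin hI2 fun v' => min_le_right _ _
      _ = coordAvg μ {a} F U * q (update U a v) := by
          rw [integral_mul_const, coordAvg_singleton_of_measurable μ a hFm U]

/-- **Upper per context**: `∫∫ min(F_v q_{v'}, F_{v'} q_v) dμ dμ ≤ ∫ min(F_v, M(U)·q_v) dμ(v)`. [ours] -/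
theorem site_acc_le (hFm : Measurable F) (hF0 : ∀ U, 0 ≤ F U) {CF : ℝ} (hFb : ∀ U, F U ≤ CF)
    (hqm : Measurable q) (hq0 : ∀ U, 0 ≤ q U) {Cq : ℝ} (hqb : ∀ U, q U ≤ Cq)
    (hq1 : ∀ U, ∫ v, q (update U a v) ∂μ = 1) (U : ι → X) :
    ∫ v, ∫ v', min (F (update U a v) * q (update U a v')) (F (update U a v') * q (update U a v)) ∂μ ∂μ ≤
      ∫ v, min (F (update U a v)) (coordAvg μ {a} F U * q (update U a v)) ∂μ := by
  have hFu : Measurable fun v' => F (update U a v') := hFm.comp (measurable_update U)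
  have hqu : Measurable fun v' => q (update U a v') := hqm.comp (measurable_update U)
  have hCF : ∀ W, 0 ≤ CF := fun W => (hF0 W).trans (hFb W)
  have hCq : ∀ W, 0 ≤ Cq := fun W => (hq0 W).trans (hqb W)
  -- the inner integral is measurable in `v` and bounded
  have hG : Measurable fun z : X × X => min (F (update U a z.1) * q (update U a z.2))
      (F (update U a z.2) * q (update U a z.1)) :=
    ((hFu.comp measurable_fst).mul (hqu.comp measurable_snd)).min
      ((hFu.comp measurable_snd).mul (hqu.comp measurable_fst))
  have hinner_m : Measurable fun v => ∫ v', min (F (update U a v) * q (update U a v'))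
      (F (update U a v') * q (update U a v)) ∂μ :=
    (hG.stronglyMeasurable.integral_prod_right (ν := μ)).measurable
  have hinner_b : ∀ v, |∫ v', min (F (update U a v) * q (update U a v'))
      (F (update U a v') * q (update U a v)) ∂μ| ≤ CF * Cq := by
    intro v
    have h0 : 0 ≤ ∫ v', min (F (update U a v) * q (update U a v')) (F (update U a v') * q (update U a v)) ∂μ :=
      integral_nonneg fun v' => le_min (mul_nonneg (hF0 _) (hq0 _)) (mul_nonneg (hF0 _) (hq0 _))
    rw [abs_of_nonneg h0]
    calc ∫ v', min (F (update U a v) * q (update U a v')) (F (update U a v') * q (update U a v)) ∂μ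
        ≤ ∫ _, CF * Cq ∂μ := by
          refine integral_mono_of_nonneg (ae_of_all _ fun v' => le_min (mul_nonneg (hF0 _) (hq0 _))
            (mul_nonneg (hF0 _) (hq0 _))) (integrable_const _) (ae_of_all _ fun v' => ?_)
          exact (min_le_left _ _).trans (mul_le_mul (hFb _) (hqb _) (hq0 _) (hCF U))
      _ = CF * Cq := by simp
  have hright_m : Measurable fun v => min (F (update U a v)) (coordAvg μ {a} F U * q (update U a v)) :=
    hFu.min (measurable_const.mul hqu)
  have hright_b : ∀ v, |min (F (update U a v)) (coordAvg μ {a} F U * q (update U a v))| ≤ CF := fun v => by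
    have hM0 : 0 ≤ coordAvg μ {a} F U := (coordAvg_mem_Icc μ {a} hFm hF0 hFb U).1
    rw [abs_of_nonneg (le_min (hF0 _) (mul_nonneg hM0 (hq0 _)))]
    exact (min_le_left _ _).trans (hFb _)
  exact integral_mono (integrable_of_measurable_abs_le μ hinner_m hinner_b)
    (integrable_of_measurable_abs_le μ hright_m hright_b)
    (fun v => site_inner_le μ hFm hF0 hFb hqm hq0 hqb hq1 U v)

end PerContext

/-! ## §3 The ceiling `ā_a ≤ m` and the total-variation form of `m` -/

section Squeeze

variable {a : ι} {F q : (ι → X) → ℝ}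

omit [Fintype ι] in
/-- The per-context acceptance `U ↦ ∫∫ min(F_v q_{v'}, F_{v'} q_v) dμ dμ` is measurable and bounded. [ours] -/
theorem siteAcc_measurable_bounded (hFm : Measurable F) (hF0 : ∀ U, 0 ≤ F U) {CF : ℝ} (hFb : ∀ U, F U ≤ CF)
    (hqm : Measurable q) (hq0 : ∀ U, 0 ≤ q U) {Cq : ℝ} (hqb : ∀ U, q U ≤ Cq) :
    Measurable (fun U : ι → X => ∫ v, ∫ v', min (F (update U a v) * q (update U a v'))
        (F (update U a v') * q (update U a v)) ∂μ ∂μ) ∧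
      ∀ U : ι → X, |∫ v, ∫ v', min (F (update U a v) * q (update U a v'))
        (F (update U a v') * q (update U a v)) ∂μ ∂μ| ≤ CF * Cq := by
  -- joint measurability on `((ι → X) × X) × X`
  have hF3a : Measurable fun z : ((ι → X) × X) × X => F (update z.1.1 a z.1.2) :=
    (measurable_comp_update a hFm).comp measurable_fst
  have hF3b : Measurable fun z : ((ι → X) × X) × X => F (update z.1.1 a z.2) :=
    (measurable_comp_update a hFm).comp ((measurable_fst.comp measurable_fst).prodMk measurable_snd)
  have hq3a : Measurable fun z : ((ι → X) × X) × X => q (update z.1.1 a z.1.2) :=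
    (measurable_comp_update a hqm).comp measurable_fst
  have hq3b : Measurable fun z : ((ι → X) × X) × X => q (update z.1.1 a z.2) :=
    (measurable_comp_update a hqm).comp ((measurable_fst.comp measurable_fst).prodMk measurable_snd)
  have hG : Measurable fun z : ((ι → X) × X) × X => min (F (update z.1.1 a z.1.2) * q (update z.1.1 a z.2))
      (F (update z.1.1 a z.2) * q (update z.1.1 a z.1.2)) := (hF3a.mul hq3b).min (hF3b.mul hq3a)
  have hinner : Measurable fun p : (ι → X) × X => ∫ v', min (F (update p.1 a p.2) * q (update p.1 a v'))
      (F (update p.1 a v') * q (update p.1 a p.2)) ∂μ :=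
    (hG.stronglyMeasurable.integral_prod_right (ν := μ)).measurable
  refine ⟨(hinner.stronglyMeasurable.integral_prod_right (ν := μ)).measurable, fun U => ?_⟩
  have hpt0 : ∀ v v', 0 ≤ min (F (update U a v) * q (update U a v')) (F (update U a v') * q (update U a v)) :=
    fun v v' => le_min (mul_nonneg (hF0 _) (hq0 _)) (mul_nonneg (hF0 _) (hq0 _))
  have hptb : ∀ v v', min (F (update U a v) * q (update U a v')) (F (update U a v') * q (update U a v)) ≤
      CF * Cq := fun v v' =>
    (min_le_left _ _).trans (mul_le_mul (hFb _) (hqb _) (hq0 _) ((hF0 U).trans (hFb U)))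
  have hin0 : ∀ v, 0 ≤ ∫ v', min (F (update U a v) * q (update U a v')) (F (update U a v') * q (update U a v)) ∂μ :=
    fun v => integral_nonneg fun v' => hpt0 v v'
  have hinb : ∀ v, ∫ v', min (F (update U a v) * q (update U a v')) (F (update U a v') * q (update U a v)) ∂μ ≤
      CF * Cq := fun v => by
    calc ∫ v', min (F (update U a v) * q (update U a v')) (F (update U a v') * q (update U a v)) ∂μ
        ≤ ∫ _, CF * Cq ∂μ := integral_mono_of_nonneg (ae_of_all _ (hpt0 v)) (integrable_const _)
          (ae_of_all _ (hptb v))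
      _ = CF * Cq := by simp
  rw [abs_of_nonneg (integral_nonneg hin0)]
  calc ∫ v, ∫ v', min (F (update U a v) * q (update U a v')) (F (update U a v') * q (update U a v)) ∂μ ∂μ
      ≤ ∫ _, CF * Cq ∂μ := integral_mono_of_nonneg (ae_of_all _ hin0) (integrable_const _) (ae_of_all _ hinb)
    _ = CF * Cq := by simp

/-- The per-context overlap `g(U) = ∫ min(F_v, M(U) q_v) dμ(v)` is measurable, `0 ≤ g ≤ M`, and
`∫ g dπ = ∫ min(F, M·q) dπ`. [ours] -/
theorem siteOverlap_facts (hFm : Measurable F) (hF0 : ∀ U, 0 ≤ F U) {CF : ℝ} (hFb : ∀ U, F U ≤ CF)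
    (hqm : Measurable q) (hq0 : ∀ U, 0 ≤ q U) :
    Measurable (fun U : ι → X => ∫ v, min (F (update U a v)) (coordAvg μ {a} F U * q (update U a v)) ∂μ) ∧
      (∀ U : ι → X, 0 ≤ ∫ v, min (F (update U a v)) (coordAvg μ {a} F U * q (update U a v)) ∂μ) ∧
      (∀ U : ι → X, ∫ v, min (F (update U a v)) (coordAvg μ {a} F U * q (update U a v)) ∂μ ≤
        coordAvg μ {a} F U) ∧
      ∫ U, ∫ v, min (F (update U a v)) (coordAvg μ {a} F U * q (update U a v)) ∂μ ∂Measure.pi (fun _ : ι => μ) =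
        ∫ U, min (F U) (coordAvg μ {a} F U * q U) ∂Measure.pi (fun _ : ι => μ) := by
  have hMm : Measurable (coordAvg μ {a} F) := measurable_coordAvg μ {a} hFm
  have hM0 : ∀ U, 0 ≤ coordAvg μ {a} F U := fun U => (coordAvg_mem_Icc μ {a} hFm hF0 hFb U).1
  have hFabs : ∀ W, |F W| ≤ CF := fun W => by rw [abs_of_nonneg (hF0 W)]; exact hFb W
  have hh : Measurable fun U : ι → X => min (F U) (coordAvg μ {a} F U * q U) := hFm.min (hMm.mul hqm)
  have hhb : ∀ U, |min (F U) (coordAvg μ {a} F U * q U)| ≤ CF := fun U => by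
    rw [abs_of_nonneg (le_min (hF0 U) (mul_nonneg (hM0 U) (hq0 U)))]
    exact (min_le_left _ _).trans (hFb U)
  -- freezing `M` at `U` is the same as resampling `min(F, M q)` (since `M(U[a↦v]) = M(U)`)
  have e : (fun U : ι → X => ∫ v, min (F (update U a v)) (coordAvg μ {a} F U * q (update U a v)) ∂μ) =
      fun U => ∫ v, (fun W => min (F W) (coordAvg μ {a} F W * q W)) (update U a v) ∂μ := by
    funext U
    refine integral_congr_ae (ae_of_all _ fun v => ?_)
    simp only [coordAvg_singleton_update]
  refine ⟨?_, fun U => integral_nonneg fun v => le_min (hF0 _) (mul_nonneg (hM0 U) (hq0 _)), fun U => ?_, ?_⟩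
  · rw [e]
    exact ((measurable_comp_update a hh).stronglyMeasurable.integral_prod_right (ν := μ)).measurable
  · calc ∫ v, min (F (update U a v)) (coordAvg μ {a} F U * q (update U a v)) ∂μ
        ≤ ∫ v, F (update U a v) ∂μ :=
          integral_mono_of_nonneg (ae_of_all _ fun v => le_min (hF0 _) (mul_nonneg (hM0 U) (hq0 _)))
            (integrable_of_measurable_abs_le μ (hFm.comp (measurable_update U)) (fun v => hFabs _))
            (ae_of_all _ fun v => min_le_left _ _)
      _ = coordAvg μ {a} F U := (coordAvg_singleton_of_measurable μ a hFm U).symm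
  · rw [e, ← pi_integral_eq_integral_integral_update μ a hh hhb]

/-- **UPPER: `ā_a ≤ m`** — the equilibrium acceptance of the Metropolised update at `a` with proposal
`q` is at most the overlap `m = Z⁻¹∫ min(F, A_aF·q) dπ` of the proposal with the exact conditional. [ours] -/
theorem siteMeanAccept_le_overlap (hFm : Measurable F) (hF0 : ∀ U, 0 ≤ F U) {CF : ℝ} (hFb : ∀ U, F U ≤ CF)
    (hZ : 0 < ∫ U, F U ∂Measure.pi (fun _ : ι => μ))
    (hqm : Measurable q) (hq0 : ∀ U, 0 ≤ q U) {Cq : ℝ} (hqb : ∀ U, q U ≤ Cq)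
    (hq1 : ∀ U, ∫ v, q (update U a v) ∂μ = 1) :
    (∫ U, ∫ v, ∫ v', min (F (update U a v) * q (update U a v')) (F (update U a v') * q (update U a v)) ∂μ ∂μ
        ∂Measure.pi (fun _ : ι => μ)) / ∫ U, F U ∂Measure.pi (fun _ : ι => μ) ≤
      (∫ U, min (F U) (coordAvg μ {a} F U * q U) ∂Measure.pi (fun _ : ι => μ)) /
        ∫ U, F U ∂Measure.pi (fun _ : ι => μ) := by
  obtain ⟨hAm, hAb⟩ := siteAcc_measurable_bounded μ (a := a) hFm hF0 hFb hqm hq0 hqb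
  obtain ⟨hgm, hg0, hgM, hgint⟩ := siteOverlap_facts μ (a := a) hFm hF0 hFb hqm hq0
  have hMb : ∀ U, coordAvg μ {a} F U ≤ CF := fun U => (coordAvg_mem_Icc μ {a} hFm hF0 hFb U).2
  refine div_le_div_of_nonneg_right ?_ hZ.le
  rw [← hgint]
  exact integral_mono (integrable_of_measurable_abs_le _ hAm hAb)
    (integrable_of_measurable_abs_le _ hgm (C := CF) (fun U => by
      rw [abs_of_nonneg (hg0 U)]; exact (hgM U).trans (hMb U)))
    (fun U => site_acc_le μ hFm hF0 hFb hqm hq0 hqb hq1 U)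

/-- **THE OVERLAP IS ONE MINUS HALF THE `L¹` DISTANCE**: `Z⁻¹∫ min(F, A_aF·q) dπ =
1 − (1/(2Z)) ∫ |F − A_aF·q| dπ`. [ours] -/
theorem siteOverlap_eq_one_sub_half_integral_abs (hFm : Measurable F) (hF0 : ∀ U, 0 ≤ F U) {CF : ℝ}
    (hFb : ∀ U, F U ≤ CF) (hZ : 0 < ∫ U, F U ∂Measure.pi (fun _ : ι => μ))
    (hqm : Measurable q) (hq0 : ∀ U, 0 ≤ q U) {Cq : ℝ} (hqb : ∀ U, q U ≤ Cq)
    (hq1 : ∀ U, ∫ v, q (update U a v) ∂μ = 1) :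
    (∫ U, min (F U) (coordAvg μ {a} F U * q U) ∂Measure.pi (fun _ : ι => μ)) /
        ∫ U, F U ∂Measure.pi (fun _ : ι => μ) =
      1 - (∫ U, |F U - coordAvg μ {a} F U * q U| ∂Measure.pi (fun _ : ι => μ)) /
        (2 * ∫ U, F U ∂Measure.pi (fun _ : ι => μ)) := by
  have hFabs : ∀ W, |F W| ≤ CF := fun W => by rw [abs_of_nonneg (hF0 W)]; exact hFb W
  have hqabs : ∀ W, |q W| ≤ Cq := fun W => by rw [abs_of_nonneg (hq0 W)]; exact hqb W
  set Z : ℝ := ∫ U, F U ∂Measure.pi (fun _ : ι => μ) with hZdef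
  have hMm : Measurable (coordAvg μ {a} F) := measurable_coordAvg μ {a} hFm
  have hMb : ∀ U, |coordAvg μ {a} F U| ≤ CF := fun U =>
    abs_le.2 (coordAvg_mem_Icc μ {a} hFm (fun η => (abs_le.1 (hFabs η)).1) (fun η => (abs_le.1 (hFabs η)).2) U)
  have hMq : ∫ U, coordAvg μ {a} F U * q U ∂Measure.pi (fun _ : ι => μ) = Z :=
    (pi_integral_coordAvg_singleton_facts μ a hFm hFabs hqm hqabs hq1).2
  have hFi : Integrable F (Measure.pi fun _ : ι => μ) := integrable_of_measurable_abs_le _ hFm hFabs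
  have hMqi : Integrable (fun U => coordAvg μ {a} F U * q U) (Measure.pi fun _ : ι => μ) :=
    integrable_of_measurable_abs_le _ (hMm.mul hqm) (C := CF * Cq) (fun U => by
      rw [abs_mul]; exact mul_le_mul (hMb U) (hqabs U) (abs_nonneg _) ((abs_nonneg _).trans (hMb U)))
  have hmin : ∀ U, min (F U) (coordAvg μ {a} F U * q U) =
      (1 / 2) * ((F U + coordAvg μ {a} F U * q U) - |F U - coordAvg μ {a} F U * q U|) := by
    intro U
    rcases le_total (F U) (coordAvg μ {a} F U * q U) with h | h
    · rw [min_eq_left h, abs_of_nonpos (sub_nonpos.2 h)]; ring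
    · rw [min_eq_right h, abs_of_nonneg (sub_nonneg.2 h)]; ring
  have hadd : Integrable (fun U => F U + coordAvg μ {a} F U * q U) (Measure.pi fun _ : ι => μ) := hFi.add hMqi
  have habs : Integrable (fun U => |F U - coordAvg μ {a} F U * q U|) (Measure.pi fun _ : ι => μ) :=
    (hFi.sub hMqi).abs
  simp_rw [hmin]
  rw [integral_const_mul, integral_sub hadd habs, integral_add hFi hMqi, hMq, ← hZdef]
  field_simp
  ring

/-- **IDENTIFICATION** (`F, q > 0`): the stationary mean of the Metropolis–Hastings acceptance
probability of the update at `a` — current state `U ∼ F dπ/Z`, proposal `v' ∼ q(U[a ↦ ·]) dμ`, acceptance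
`min(1, F(U[a↦v'])q(U)/(F(U)q(U[a↦v'])))` — equals `Z⁻¹∫_U ∫_v ∫_{v'} min(F_v q_{v'}, F_{v'} q_v)`.
[ours] -/
theorem siteMeanAccept_eq (hFm : Measurable F) {cF CF : ℝ} (hcF : 0 < cF) (hFlo : ∀ U, cF ≤ F U)
    (hFb : ∀ U, F U ≤ CF) (hqm : Measurable q) {cq Cq : ℝ} (hcq : 0 < cq) (hqlo : ∀ U, cq ≤ q U)
    (hqb : ∀ U, q U ≤ Cq) :
    ∫ U, F U * ∫ v', q (update U a v') *
        min 1 (F (update U a v') * q U / (F U * q (update U a v'))) ∂μ ∂Measure.pi (fun _ : ι => μ) =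
      ∫ U, ∫ v, ∫ v', min (F (update U a v) * q (update U a v')) (F (update U a v') * q (update U a v)) ∂μ ∂μ
        ∂Measure.pi (fun _ : ι => μ) := by
  have hF0 : ∀ U, 0 < F U := fun U => hcF.trans_le (hFlo U)
  have hq0 : ∀ U, 0 < q U := fun U => hcq.trans_le (hqlo U)
  have hFabs : ∀ W, |F W| ≤ CF := fun W => by rw [abs_of_pos (hF0 W)]; exact hFb W
  have hCq : ∀ W : ι → X, 0 ≤ Cq := fun W => (hq0 W).le.trans (hqb W)
  -- the integrand `h(U) = F(U)·∫ q_{v'} min(1, ratio)` is bounded measurable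
  have hker : Measurable fun p : (ι → X) × X => q (update p.1 a p.2) *
      min 1 (F (update p.1 a p.2) * q p.1 / (F p.1 * q (update p.1 a p.2))) :=
    (measurable_comp_update a hqm).mul (measurable_const.min
      (((measurable_comp_update a hFm).mul (hqm.comp measurable_fst)).div
        ((hFm.comp measurable_fst).mul (measurable_comp_update a hqm))))
  have hint_m : Measurable fun U : ι → X => ∫ v', q (update U a v') *
      min 1 (F (update U a v') * q U / (F U * q (update U a v'))) ∂μ :=
    (hker.stronglyMeasurable.integral_prod_right (ν := μ)).measurable
  have hker0 : ∀ (U : ι → X) (v' : X), 0 ≤ q (update U a v') *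
      min 1 (F (update U a v') * q U / (F U * q (update U a v'))) := fun U v' =>
    mul_nonneg (hq0 _).le (le_min zero_le_one (div_nonneg (mul_nonneg (hF0 _).le (hq0 _).le)
      (mul_nonneg (hF0 _).le (hq0 _).le)))
  have hint_b : ∀ U : ι → X, |∫ v', q (update U a v') *
      min 1 (F (update U a v') * q U / (F U * q (update U a v'))) ∂μ| ≤ Cq := fun U => by
    rw [abs_of_nonneg (integral_nonneg (hker0 U))]
    calc ∫ v', q (update U a v') * min 1 (F (update U a v') * q U / (F U * q (update U a v'))) ∂μ
        ≤ ∫ _, Cq ∂μ := integral_mono_of_nonneg (ae_of_all _ (hker0 U)) (integrable_const Cq)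
          (ae_of_all _ fun v' => (mul_le_mul (hqb _) (min_le_left _ _) (le_min zero_le_one (div_nonneg
            (mul_nonneg (hF0 _).le (hq0 _).le) (mul_nonneg (hF0 _).le (hq0 _).le))) (hCq U)).trans
            (by rw [mul_one]))
      _ = Cq := by simp
  have hh : Measurable fun U : ι → X => F U * ∫ v', q (update U a v') *
      min 1 (F (update U a v') * q U / (F U * q (update U a v'))) ∂μ := hFm.mul hint_m
  have hhb : ∀ U, |F U * ∫ v', q (update U a v') *
      min 1 (F (update U a v') * q U / (F U * q (update U a v'))) ∂μ| ≤ CF * Cq := fun U => by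
    rw [abs_mul]; exact mul_le_mul (hFabs U) (hint_b U) (abs_nonneg _) ((abs_nonneg _).trans (hFabs U))
  rw [pi_integral_eq_integral_integral_update μ a hh hhb]
  refine integral_congr_ae (ae_of_all _ fun U => integral_congr_ae (ae_of_all _ fun v => ?_))
  show F (update U a v) * ∫ v', q (update (update U a v) a v') *
      min 1 (F (update (update U a v) a v') * q (update U a v) / (F (update U a v) * q (update (update U a v) a v'))) ∂μ =
    ∫ v', min (F (update U a v) * q (update U a v')) (F (update U a v') * q (update U a v)) ∂μ
  simp only [update_idem]
  rw [← integral_const_mul]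
  refine integral_congr_ae (ae_of_all _ fun v' => ?_)
  show F (update U a v) * (q (update U a v') *
      min 1 (F (update U a v') * q (update U a v) / (F (update U a v) * q (update U a v')))) =
    min (F (update U a v) * q (update U a v')) (F (update U a v') * q (update U a v))
  have hpos : 0 < F (update U a v) * q (update U a v') := mul_pos (hF0 _) (hq0 _)
  rw [← mul_assoc, mul_min_of_nonneg _ _ hpos.le, mul_one, mul_div_cancel₀ _ hpos.ne']

end Squeeze


end Summit.Ventures.LatticeQCDFlow.Theory2.Autoregressive

end
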